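import Literature.AlgebraicGeometry.Frobenioids.ArithmeticFrobenioidThm64ivTransport
import Literature.AlgebraicGeometry.Frobenioids.ArithmeticFrobenioidThm64ivNormPreservation
import Literature.AlgebraicGeometry.Frobenioids.ModelFrobenioidTypeBridge
import HarnessLib

/-!
# Frobenioids I, Theorem 6.4 (iv) at the constructions, packaged: from the typed [FrdI] Cor. 4.11 (iv) for an
# equivalence `Ψ` of arithmetic Frobenioids to `Ψ^Base`, norm-preserving place bijections, and `L₁ ≅ L₂`

Mochizuki, *The geometry of Frobenioids I: the general theory*, Kyushu J. Math. **62** (2008) 293–400, §6,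
Thm. 6.4 (iv) p. 115 l. 17–29, proof p. 116 l. 17–35 [cite: MochizukiFrdI2008, Thm. 6.4 (iv) p.115].

PROOF-ONLY file (cell abc-iut, `plan/L1/SUBDAG-FrdI-Thm64.md` §G, DATA-LEVEL composition row T64iv/L08 —
packaging of `ArithmeticFrobenioidThm64ivTransport.lean` (row T64iv/L01) with
`ArithmeticFrobenioidThm64ivNormPreservation.lean` (piece G-A); L1-lead R108 (4) row (G); seat abc-iut-L1-d7;
the SCHEMA-LETTER closer `Thm64iv_holds` over abc-iut-L1-t3's `Thm64iv` is abc-iut-L1-t3's row «T64-ASSEMBLIES»,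
R112 (9), and consumes these BY NAME):
* `Thm64iv_arith_of_cor411iv` — for an equivalence `Ψ : C_{K₁/F₁} ⥲ C_{K₂/F₂}` with the typed conclusion of
  Cor. 4.11 (iv) (binder `h411iv` over `arithFrobenioidOps`; its premises hold at `C_{K/F}`): there are `Ψ^Base`
  (an equivalence) with `η : Base₂ ∘ Ψ ≅ Ψ^Base ∘ Base₁` and, for every `X = Spec L₁`, a bijection `π_X` of the
  finite places of `L₁` and of `L₂ := (Ψ^Base X).L` preserving NORMS and residue characteristics, and
  `L₁ ≅ L₂` whenever `L₁` is Galois over `ℚ`;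
* `Thm64iv_arith_of_cor411iv'` — the same from the binder in the `PreFrobenioidData.ofFunctor Φ (toElem …)` /
  `ModelFrobenioid.data` presentation (the letter of abc-iut-L1-t14's `FrdI.cor411iv_ofFunctor_of_isOfFSMType`;
  the two presentations agree by `ModelFrobenioid.ofModel_eq_data`, `rfl`);
* `Thm64iv_arith_oneUniqueSquare_of_cor411ii` — with the typed Cor. 4.11 (ii) as well, THIS `Ψ^Base` fits the
  `1`-unique square of abc-iut-L1-t3's schema hypothesis.
Row T64iv/L07b (compatibility with `F₁ ≅ F₂`) = abc-iut-L1-d4's p422145, not claimed; "`deg(Ψ^rlf) = 1`" for THE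
`Ψ^rlf` of Thm. 6.4 (ii) = the T64ii assembly.  No definitions, no named facts; nothing here bears on [IUTchIII].
-/

noncomputable section

namespace Literature.AlgebraicGeometry.Frobenioids

open CategoryTheory Opposite NumberField
open PreFrobenioidData (OneUniqueSquare)

section Arith

variable {F₁ : Type} [Field F₁] [NumberField F₁] {K₁ : Type} [Field K₁] [Algebra F₁ K₁] [IsGalois F₁ K₁]
variable {F₂ : Type} [Field F₂] [NumberField F₂] {K₂ : Type} [Field K₂] [Algebra F₂ K₂] [IsGalois F₂ K₂]

/-- **[FrdI] Thm. 6.4 (iv) at the constructions, from the typed Cor. 4.11 (iv)**: `Ψ^Base` (an equivalence,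
`η`), norm- and residue-characteristic-preserving bijections `π_X` of finite places (generator ↦ generator), and
`L₁ ≅ (Ψ^Base X).L` for `L₁ = X.L` Galois over `ℚ`. [cite: MochizukiFrdI2008, Thm. 6.4 (iv) p.115] -/
theorem Thm64iv_arith_of_cor411iv (Ψ : arithFrobenioid F₁ K₁ ≌ arithFrobenioid F₂ K₂)
    (h411iv : PreFrobenioidData.Cor411iv (arithFrobenioidOps F₁ K₁) (arithFrobenioidOps F₂ K₂) Ψ
      (PreFrobenioid.rsParams (arithFrobenioid_isFrobenioid F₁ K₁) fun a 𝔭 => PrimarySupp a 𝔭)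
      (PreFrobenioid.rsParams (arithFrobenioid_isFrobenioid F₂ K₂) fun a 𝔭 => PrimarySupp a 𝔭)) :
    ∃ (ΨBase : FinSubextCat F₁ K₁ ⥤ FinSubextCat F₂ K₂)
      (_ : Ψ.functor ⋙ (arithFrobenioidOps F₂ K₂).base ≅ (arithFrobenioidOps F₁ K₁).base ⋙ ΨBase)
      (π : ∀ X : FinSubextCat F₁ K₁, FinitePlace X.L ≃ FinitePlace (ΨBase.obj X).L),
      ΨBase.IsEquivalence ∧
      (∀ (X : FinSubextCat F₁ K₁) (w : FinitePlace X.L), logNorm (π X w) = logNorm w) ∧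
      (∀ (X : FinSubextCat F₁ K₁) (w : FinitePlace X.L), residueChar (π X w) = residueChar w) ∧
      ∀ X : FinSubextCat F₁ K₁, IsGalois ℚ X.L → Nonempty (X.L ≃+* (ΨBase.obj X).L) := by
  obtain ⟨ΨBase, E, η, π, hEq, -, hgen, hdiv⟩ := exists_transport_of_cor411iv Ψ h411iv
  haveI := hEq
  refine ⟨ΨBase, η, π, hEq, fun X w => arith_logNorm_transport Ψ E η hdiv X (π X) (hgen X) w,
    fun X w => arith_residueChar_transport Ψ E η hdiv X (π X) (hgen X) w, fun X hX => ?_⟩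
  obtain ⟨c, hc, hg⟩ := arith_exists_logNorm_eq_mul Ψ E η hdiv X (π X) (hgen X)
  exact (Thm64iv_at_of_logNorm_transport ΨBase X (π X) c hc hg).2 hX

/-- The same from the Cor. 4.11 (iv) binder in the `PreFrobenioidData.ofFunctor Φ (ModelFrobenioid.toElem …)` =
`ModelFrobenioid.data …` presentation (the letter of `FrdI.cor411iv_ofFunctor_of_isOfFSMType`); the two
presentations of the operations of `C_{K/F}` agree definitionally (`ModelFrobenioid.ofModel_eq_data`).
[cite: MochizukiFrdI2008, Thm. 6.4 (iv) p.115] -/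
theorem Thm64iv_arith_of_cor411iv' (Ψ : arithFrobenioid F₁ K₁ ≌ arithFrobenioid F₂ K₂)
    (h411iv : PreFrobenioidData.Cor411iv
      (ModelFrobenioid.data (arithDivisorFunctor F₁ K₁) (unitsFunctor F₁ K₁) (divNatTrans F₁ K₁))
      (ModelFrobenioid.data (arithDivisorFunctor F₂ K₂) (unitsFunctor F₂ K₂) (divNatTrans F₂ K₂)) Ψ
      (PreFrobenioid.rsParams (arithFrobenioid_isFrobenioid F₁ K₁) fun a 𝔭 => PrimarySupp a 𝔭)
      (PreFrobenioid.rsParams (arithFrobenioid_isFrobenioid F₂ K₂) fun a 𝔭 => PrimarySupp a 𝔭)) :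
    ∃ (ΨBase : FinSubextCat F₁ K₁ ⥤ FinSubextCat F₂ K₂)
      (_ : Ψ.functor ⋙ (arithFrobenioidOps F₂ K₂).base ≅ (arithFrobenioidOps F₁ K₁).base ⋙ ΨBase)
      (π : ∀ X : FinSubextCat F₁ K₁, FinitePlace X.L ≃ FinitePlace (ΨBase.obj X).L),
      ΨBase.IsEquivalence ∧
      (∀ (X : FinSubextCat F₁ K₁) (w : FinitePlace X.L), logNorm (π X w) = logNorm w) ∧
      (∀ (X : FinSubextCat F₁ K₁) (w : FinitePlace X.L), residueChar (π X w) = residueChar w) ∧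
      ∀ X : FinSubextCat F₁ K₁, IsGalois ℚ X.L → Nonempty (X.L ≃+* (ΨBase.obj X).L) :=
  Thm64iv_arith_of_cor411iv Ψ h411iv

/-- With the typed Cor. 4.11 (ii) as well (binder `h411ii`), the `Ψ^Base` of the Cor. 4.11 (iv) datum fits the
`1`-UNIQUE square `PreFrobenioidData.OneUniqueSquare Ψ.functor Base₁ Base₂ Ψ^Base` (hypothesis shape of
abc-iut-L1-t3's schema `Thm64iv`), and carries the norm-preserving bijections and the field isomorphisms.
[cite: MochizukiFrdI2008, Thm. 6.4 (iv) p.115] -/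
theorem Thm64iv_arith_oneUniqueSquare_of_cor411ii (Ψ : arithFrobenioid F₁ K₁ ≌ arithFrobenioid F₂ K₂)
    (h411ii : PreFrobenioidData.Cor411ii (arithFrobenioidOps F₁ K₁) (arithFrobenioidOps F₂ K₂) Ψ)
    (h411iv : PreFrobenioidData.Cor411iv (arithFrobenioidOps F₁ K₁) (arithFrobenioidOps F₂ K₂) Ψ
      (PreFrobenioid.rsParams (arithFrobenioid_isFrobenioid F₁ K₁) fun a 𝔭 => PrimarySupp a 𝔭)
      (PreFrobenioid.rsParams (arithFrobenioid_isFrobenioid F₂ K₂) fun a 𝔭 => PrimarySupp a 𝔭)) :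
    ∃ (ΨBase : FinSubextCat F₁ K₁ ⥤ FinSubextCat F₂ K₂)
      (π : ∀ X : FinSubextCat F₁ K₁, FinitePlace X.L ≃ FinitePlace (ΨBase.obj X).L),
      OneUniqueSquare Ψ.functor (arithFrobenioidOps F₁ K₁).base (arithFrobenioidOps F₂ K₂).base ΨBase ∧
      (∀ (X : FinSubextCat F₁ K₁) (w : FinitePlace X.L), logNorm (π X w) = logNorm w) ∧
      ∀ X : FinSubextCat F₁ K₁, IsGalois ℚ X.L → Nonempty (X.L ≃+* (ΨBase.obj X).L) := by
  obtain ⟨ΨBase, η, π, hEq, hnorm, -, hiso⟩ := Thm64iv_arith_of_cor411iv Ψ h411iv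
  exact ⟨ΨBase, π, oneUniqueSquare_of_cor411ii_of_iso Ψ h411ii hEq η, hnorm, hiso⟩

end Arith

end Literature.AlgebraicGeometry.Frobenioids

end
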